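import Literature.MathematicalPhysics.QuantumFieldTheory.Balaban1983to89.B3Op116HolderKernelRegularTorusZero
import Literature.MathematicalPhysics.QuantumFieldTheory.Balaban1983to89.B3Op116RegionSources
import Literature.MathematicalPhysics.QuantumFieldTheory.Balaban1983to89.B3Op116DKernelRegularRegion

/-!
# Bałaban, *(Higgs)₂,₃ quantum fields in a finite volume III. Renormalization* [B3] — THE HÖLDER ROW OF THE KERNEL OF (1.16) p. 414 ON A
REGION `Ω ⊆ T_ε` UNDER PRINT'S SUPPORT HYPOTHESIS (p. 412): FILE 4γ's Hölder row `G_k(Ω,B̃)V_k(Ã,B̃)·w` for an arbitrary inner family `w`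
controlled at INTERIOR points — file F3a of the region twin of the (1.16) programme (B3-CLOSURE §5 item 20)

statement-level skeleton of published theorems with citation tags; proofs where landed; nothing here is a claim about the Yang–Mills mass gap

T. Bałaban, Commun. Math. Phys. **88** (1983) 411–445 [cite: Balaban1983Higgs3]; part I, Commun. Math. Phys. **85** (1982) 603–636
[cite: Balaban1982Higgs1]; *Regularity and decay of lattice Green's functions*, Commun. Math. Phys. **89** (1983) 571–597
[cite: Balaban1983RegularityDecay].  PDFs held: `paper:balaban1983-higgs-2-3-quantum-fields-finite-volume` (journal page = PDF page + 410;
p. 412 = `p0002.txt`, p. 414 = `p0004.txt`, p. 426 = `p0016.txt`).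

CITATION HEADER (lean-in-tree rule).  Cell `lit-balaban` (HOME `run/shared/lean/pub/lit-balaban/`), proof seat **p35** gen 23
(unit `lit-balaban-p35`); p40 g75's TAKING of B3-CLOSURE §5 item 20 (HOME/STATUS 2026-08-23T09:21:23Z: F1 `B3Op116RegionSources` = p40,
F2 `B3Op116DKernelRegularRegion` = p40, **F3 = p35** (accepted 09:27:29Z), F4/F5 = p40).  SKELETON rows **B3.Eq2.5** (decl of record
`B3Sect2StatementsPart2.ScaledKernels.Ineq25At`, fold owner r15; head REVERTED to `typed` 2026-08-23T08:58Z pending the region twin) /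
**B3.Eq1.16** (analytic half) — LOCATED MEMBER, no head claim.  USED BY NAME, never restated: p40's `B3Op116RegionSources.{DeepBlk, cutV, cutD,
cutK, cutV_le_of, cutD_le_of, cutK_le_of, cutV_nonneg, cutD_nonneg, cutK_nonneg, norm_mapE_srcV_region_le}` (F1: the L-form row on a region through a
vector-valued linear functional, truncated to the interior), p35's `B3Op116HolderKernelRegularTorus.{holT, holT_apply, holC, row_le_of_kernel_le_add}`
(FILE 4γ), `B3Op116MajorantStep.{maj, row_step_le, stepC}` (FILE 4β₁), `B3Op116DKernelRegularTorus.{rateAt, cvAt, cdAt, seqC_pos, seqC_succ, kap4, cK1}`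
(FILE 4β₂: the SAME constants as on the torus), p33's `B3Op116MajorantConvolution.majorant_le_top`, r14's `B3Ineq210RegularRegion.Interior`; the
region (2.11) row enters as the HYPOTHESIS `h211` in the exact shape of p35's `B3Op116BoxRows.hcol_le_region` (v1.2 p360021), which discharges it.

## What is printed

[B3] p. 412 [PDF 2]: *"we will assume that |A|, |∂^ηA|, |∂^ηB| and their Hölder norms … ≤ O(1)p(L^kε) and dist(supp A, ∂Ω) > 2r(L^kε)"*;
p. 414 [PDF 4]: *"[G_k(Ω,B̃)V_k(Ã,B̃)]^n G_k(Ω,Ã+B̃) [V_k(Ã,B̃)G_k(Ω,B̃)]^{n′}, (1.16) … the Hölder norms of the covariant derivatives of this kernel,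
the norms defined for example in the inequalities (I.2.24) and (I.2.25) of Proposition I.2.1, are exponentially decaying with the distance of
the arguments and are uniformly bounded by O(1)(e(L^kε)^{1−α})^{n+n′}"*; p. 426 (2.11) [PDF 16] (the Hölder member of the pieces of `G_k(Ω,B̃)`).

## What this file proves, and how

**`holder_row_family_le_region`** — the region twin of p35's `B3Op116HolderKernelRegularTorusZero.holder_row_family_le`: on a region `Ω`, for
`Ã = A` with the SUPPORT HYPOTHESIS `A_b ≠ 0 ⇒ DeepBlk b₋ ∧ DeepBlk b₊` (print p. 412; p40's F1), `sup_b|A_b| ≤ s`, `A` regular with `δ_A`, the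
region (2.11) row of `G_k(Ω,B̃)` at interior points with constant `cH` (`h211`), and a family `w_{i′}` in FILE 4β₂'s state `J` AT INTERIOR POINTS
(`∀ y, Interior y → ‖w_{i′}(y)‖ ≤ 𝔪_k(cvAt J, 2+J; δ_J)(y,x′)`, `∀ b, Interior b₋ → ‖(D^ε_{B̃}w_{i′})(b)‖ ≤ 𝔪_k(cdAt J, 1+J; δ_J)(b₋,x′)`, the unit
triple), for interior `x₁ ≠ x₂`, any `x′`, admissible `Γ` and `d < 1 + (J+1) − α`:
`ε^{−d}Σ_{i′}‖U(B̃(Γ))(D^ε_{B̃}G_k(Ω,B̃)V_kw_{i′})(⟨x₂,μ⟩) − (D^ε_{B̃}G_k(Ω,B̃)V_kw_{i′})(⟨x₁,μ⟩)‖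
≤ (ε|x₁−x₂|)^α·holC(J)·(L^kε)^{J+1}·((L^kε)((L^kε)^d)^{−1}((L^kε)^α)^{−1})·exp(−δ_{J+1}·min(|x₁−x′|,|x₂−x′|)/L^k)` — the SAME constant and rate
as on the torus.  Mechanism: p40's truncated L-form row `norm_mapE_srcV_region_le` through the Hölder functional `T = holT ∘ G_k(Ω,B̃)` (every
charge and every column truncated to `Interior`, where the hypotheses hold; off the interior they are `0`), the truncated Hölder column bounded
by `h211` (`cutK_le_of`), then FILE 4γ's `row_le_of_kernel_le_add` + FILE 4β₁'s `row_step_le` at `a_K = 1 − α` for the two anchors + p33's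
`majorant_le_top` — the 4γ/Zero argument verbatim on the truncations.  This is the Hölder engine of the region twin: with p40's F2 region states
of `(1.16)_{n,n′}e` and of the pure-`B̃` chain it yields the binders `hH`/`hH′` of p40's general-`Ω` `B3Ineq25Op116Smooth.ineq25At_op116_smooth_of_bounds`
(file F3b, after F2).

v1.1 (§4 appended after p40's F2 `B3Op116DKernelRegularRegion` p361276 landed; v1.0's copy of the (I.3.44) identity
`W_apply_eq_op116_one_zero_region` dropped in favour of F2's identical, earlier-landed declaration — all other v1.0 declarations byte-identical): the CLOSED binders `kernel116_holder_le_region` (n ≥ 1)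
and `kernel116_holder_le_zero_left_region'` (n = 0) under F2's hypothesis list (r15's `Ineq210 δ₁ C` on r14's `regRegionKernels … Ω (B̃ | Ã+B̃)`,
the support hypothesis, interior `x′`) — §3 fed with F2's `state_op116_cb_region`, `state_chainB_region`, `base_state_region`.

## Honest scope

Region `Ω` arbitrary finite subset of `T_ε` here (the big-block-union structure enters only through the hypothesis `h211`, discharged by
`hcol_le_region` for big-block unions); the support hypothesis is print's p. 412 with `2r(L^kε)` READ AS p40's `DeepBlk` margin (declared
divergence of constants only, GAPS G-B3-16); inner states are hypotheses (F2 produces them); torus constants `holC`, `rateAt` unchanged.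
Theorems only: no `def`, no new named fact, no `sorry`; axioms standard.  Value = located engine of a by-reference step of B3 — NOT summit progress
and nothing about the Yang–Mills mass gap.
-/

noncomputable section

open scoped BigOperators

namespace Literature.MathematicalPhysics.QuantumFieldTheory.Balaban1983to89.B3Op116HolderKernelRegularRegion

open HiggsLattice (ChargeData ScalarField covDeriv)
open HiggsCovariance (propagatorK E)
open HiggsAveraging (blockK blockIter)
open B1Eq230FluctCov (Ix cb)
open B1TorusChainTransport (hol)
open B3Ineq211RegularTorus (IsAdm)
open B3Ineq210RegularRegion (Interior)
open B3Op116SourceForm (srcV op116_zero_zero_apply op116_succ_left_apply op116_succ_right_apply)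
open B3Eq116TwoSidedExpansion (op116)
open B3Op116MajorantStep (maj maj_nonneg maj_rate_mono stepC stepC_nonneg row_step_le)
open B3Op116DKernelRegularTorus (rateAt cvAt cdAt seqC_pos seqC_succ kap4 kap4_nonneg cK1 cK1_ge)
open B3Op116MajorantConvolution (majorant_le_top)
open B3Op116HolderKernelRegularTorus (holT holT_apply holC row_le_of_kernel_le_add mesh_rpow_split_holder exp_add_exp_le_two_exp_min)
open B3Op116RegionSources (DeepBlk cutV cutD cutK cutV_le_of cutD_le_of cutK_le_of cutV_nonneg cutD_nonneg cutK_nonneg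
  norm_mapE_srcV_region_le)

variable {P : HiggsLattice.Params} {N : ℕ}

/-! ## §1 FILE 4γ's Hölder row on a region, for an inner family controlled at interior points -/

section Row

variable {C : ChargeData N} {A B : HiggsLattice.VecField P 0} {msq a : ℝ} {k K₀ : ℕ} {Ω : Finset (HiggsLattice.Site P 0)}
  {δ₁ Cst s δA α cH : ℝ}

variable (hδ₁ : 0 < δ₁) (hδ₁1 : δ₁ ≤ 1) (hCst : 0 ≤ Cst)
  (hk : 1 ≤ k) (hkK : k ≤ P.K) (i₀ : Ix N)
  (hs : 0 ≤ s) (hA : ∀ b : HiggsLattice.PBond P 0, |A b| ≤ s) (hδA : 0 ≤ δA)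
  (hregA : ∀ (z : HiggsLattice.Site P 0) (μ ν : Fin P.d), |A ⟨z.shift ν, μ⟩ - A ⟨z, μ⟩| ≤ δA)
  (hAS : ∀ b : HiggsLattice.PBond P 0, A b ≠ 0 → DeepBlk k K₀ Ω b.src ∧ DeepBlk k K₀ Ω b.tgt)
  (hα1 : α < 1) (hcH : 0 ≤ cH)
  (h211 : ∀ (μ : Fin P.d) (x₁ x₂ y : HiggsLattice.Site P 0), Interior k K₀ Ω x₁ → Interior k K₀ Ω x₂ → Interior k K₀ Ω y →
    x₁ ≠ x₂ → ∀ Γ : List (HiggsLattice.Site P 0), IsAdm x₁ x₂ Γ →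
    (∑ i : Ix N, ‖hol C B x₁ Γ (covDeriv C B (propagatorK C Ω B msq a k (cb P N 0 (y, i))) ⟨x₂, μ⟩)
        - covDeriv C B (propagatorK C Ω B msq a k (cb P N 0 (y, i))) ⟨x₁, μ⟩‖)
        / (P.mesh 0 * (HiggsLattice.Site.tdist x₁ x₂ : ℝ)) ^ α
      ≤ ∑ j ∈ Finset.range k, cH * P.mesh j ^ (((1 : ℝ) - α) - (P.d : ℝ)) *
          (Real.exp (-(δ₁ * (P.mesh j)⁻¹ * (P.mesh 0 * (HiggsLattice.Site.tdist x₁ y : ℝ)))) +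
            Real.exp (-(δ₁ * (P.mesh j)⁻¹ * (P.mesh 0 * (HiggsLattice.Site.tdist x₂ y : ℝ))))))
include hδ₁ hδ₁1 hCst hk hkK i₀ hs hA hδA hregA hAS hα1 hcH h211

/-- **THE HÖLDER ROW OF `G_k(Ω,B̃)V_k(Ã,B̃)` ON A REGION, FOR A FAMILY IN THE STATE `J` AT INTERIOR POINTS** (the region twin of
`B3Op116HolderKernelRegularTorusZero.holder_row_family_le`; print's support hypothesis p. 412): if every `w_{i′}` satisfies
`‖w_{i′}(y)‖ ≤ 𝔪_k(cvAt J, 2+J; δ_J)(y,x′)` at interior `y` and `‖(D^ε_{B̃}w_{i′})(b)‖ ≤ 𝔪_k(cdAt J, 1+J; δ_J)(b₋,x′)` at bonds from interior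
sites (the unit triple of FILE 4β₂), then for interior `x₁ ≠ x₂`, every `x′`, admissible `Γ` and `d < 1 + (J+1) − α`:
`ε^{−d}Σ_{i′}‖U(B̃(Γ))(D^ε_{B̃}G_k(Ω,B̃)V_kw_{i′})(⟨x₂,μ⟩) − (D^ε_{B̃}G_k(Ω,B̃)V_kw_{i′})(⟨x₁,μ⟩)‖
≤ (ε|x₁−x₂|)^α·holC(J)·(L^kε)^{J+1}·((L^kε)((L^kε)^d)^{−1}((L^kε)^α)^{−1})·exp(−δ_{J+1}·min(|x₁−x′|,|x₂−x′|)/L^k)`.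
[cite: Balaban1983Higgs3, (1.16) p.414, p.412, (2.5) p.424, (2.11) p.426] [cite: Balaban1982Higgs1, Prop. 2.1 (2.24) p.610, (3.16) p.615] [cite: Balaban1983RegularityDecay, Theorem p.573] -/
theorem holder_row_family_le_region (hL : 1 < P.L) (J : ℕ) (hd : (P.d : ℝ) < 1 + ((J + 1 : ℕ) : ℝ) - α) (μ : Fin P.d)
    (x₁ x₂ x' : HiggsLattice.Site P 0) (hx₁ : Interior k K₀ Ω x₁) (hx₂ : Interior k K₀ Ω x₂) (hne : x₁ ≠ x₂)
    (Γ : List (HiggsLattice.Site P 0)) (hΓ : IsAdm x₁ x₂ Γ)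
    (W : Ix N → ScalarField P 0 N)
    (hW : ∀ i' : Ix N,
      (∀ y, Interior k K₀ Ω y → ‖W i' y‖ ≤ maj P k (cvAt P N C k a Cst s δA δ₁ (P.mesh 0 ^ P.d * Cst) (cK1 P C k Cst s) J) (2 + (J : ℝ))
          (rateAt P N C k a Cst s δA δ₁ (P.mesh 0 ^ P.d * Cst) (cK1 P C k Cst s) J) y x') ∧
      (∀ b, Interior k K₀ Ω b.src → ‖covDeriv C B (W i') b‖ ≤ maj P k (cdAt P N C k a Cst s δA δ₁ (P.mesh 0 ^ P.d * Cst) (cK1 P C k Cst s) J)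
          (1 + (J : ℝ)) (rateAt P N C k a Cst s δA δ₁ (P.mesh 0 ^ P.d * Cst) (cK1 P C k Cst s) J) b.src x')) :
    (P.mesh 0 ^ P.d)⁻¹ * ∑ i' : Ix N,
        ‖holT C B x₁ x₂ Γ μ (propagatorK C Ω B msq a k (srcV C A B k Ω a (W i')))‖
      ≤ (P.mesh 0 * (HiggsLattice.Site.tdist x₁ x₂ : ℝ)) ^ α *
          (holC P N C k a δ₁ Cst s δA α cH J * P.mesh k ^ (J + 1) *
            (P.mesh k * (P.mesh k ^ P.d)⁻¹ * (P.mesh k ^ α)⁻¹)) *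
          Real.exp (-(rateAt P N C k a Cst s δA δ₁ (P.mesh 0 ^ P.d * Cst) (cK1 P C k Cst s) (J + 1) *
            (min (HiggsLattice.Site.tdist x₁ x' : ℝ) (HiggsLattice.Site.tdist x₂ x' : ℝ) / (P.L : ℝ) ^ k))) := by
  have hL1' : (1 : ℝ) < (P.L : ℝ) := by exact_mod_cast hL
  have hc : 0 ≤ P.mesh 0 ^ P.d * Cst := mul_nonneg (pow_nonneg (P.mesh_pos 0).le _) hCst
  obtain ⟨-, hcK1⟩ := cK1_ge (P := P) (C := C) (k := k) hCst hs
  obtain ⟨hr0, hrδ, hcv0, hcd0⟩ := seqC_pos (P := P) (N := N) (C := C) (k := k) (a := a) (Cst := Cst) (s := s) (δA := δA)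
    (δ₀ := δ₁) (cv₀ := P.mesh 0 ^ P.d * Cst) (cd₀ := cK1 P C k Cst s) hL hδ₁ le_rfl hc hcK1 hCst hs hδA J
  have hes : 0 ≤ |C.e| * s := mul_nonneg (abs_nonneg _) hs
  have hκ₂ : 0 ≤ (P.mesh 0)⁻¹ * (|C.e| * δA) := mul_nonneg (inv_nonneg.mpr (P.mesh_pos 0).le) (mul_nonneg (abs_nonneg _) hδA)
  have hκ₄ : 0 ≤ kap4 P C k a s := kap4_nonneg hs
  have haK : 0 < 1 - α := by linarith
  have hav : (1 : ℝ) < 2 + (J : ℝ) := by have := (Nat.cast_nonneg J : (0:ℝ) ≤ J); linarith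
  have hε : 0 ≤ (P.mesh 0 ^ P.d)⁻¹ := inv_nonneg.mpr (pow_nonneg (P.mesh_pos 0).le _)
  -- the Hölder prefactor
  set q : ℝ := (P.mesh 0 * (HiggsLattice.Site.tdist x₁ x₂ : ℝ)) ^ α with hq
  have ht12 : 0 < P.mesh 0 * (HiggsLattice.Site.tdist x₁ x₂ : ℝ) := by
    have h1 : (1 : ℝ) ≤ (HiggsLattice.Site.tdist x₁ x₂ : ℝ) := by
      exact_mod_cast B3Ineq211RegularTorus.one_le_tdist_of_ne' (Ne.symm hne)
    have := P.mesh_pos 0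
    positivity
  have hq0 : 0 < q := Real.rpow_pos_of_pos ht12 α
  -- the two one-anchor majorants of the Hölder column, at the rate of the state J
  set δJ := rateAt P N C k a Cst s δA δ₁ (P.mesh 0 ^ P.d * Cst) (cK1 P C k Cst s) J with hδJ
  set M₁ : HiggsLattice.Site P 0 → ℝ := fun y => maj P k cH (1 - α) δJ x₁ y with hM₁
  set M₂ : HiggsLattice.Site P 0 → ℝ := fun y => maj P k cH (1 - α) δJ x₂ y with hM₂
  -- the Hölder functional through the region propagator, and its truncated column
  set T : ScalarField P 0 N →ₗ[ℝ] E N :=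
    holT C B x₁ x₂ Γ μ ∘ₗ (propagatorK C Ω B msq a k : ScalarField P 0 N →ₗ[ℝ] ScalarField P 0 N) with hT
  have hT' : ∀ φ : ScalarField P 0 N, T φ = holT C B x₁ x₂ Γ μ (propagatorK C Ω B msq a k φ) := fun φ => rfl
  set K : HiggsLattice.Site P 0 → ℝ := fun y => cutK k K₀ Ω T y with hK
  have hMM0 : ∀ y, 0 ≤ q * (M₁ y + M₂ y) := fun y =>
    mul_nonneg hq0.le (add_nonneg (maj_nonneg hcH x₁ y) (maj_nonneg hcH x₂ y))
  have hKle : ∀ y, K y ≤ q * (M₁ y + M₂ y) := by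
    intro y
    refine cutK_le_of T hMM0 (fun z hz => ?_) y
    have h := h211 μ x₁ x₂ z hx₁ hx₂ hz hne Γ hΓ
    rw [div_le_iff₀ hq0] at h
    have hsplit : (∑ j ∈ Finset.range k, cH * P.mesh j ^ (((1 : ℝ) - α) - (P.d : ℝ)) *
          (Real.exp (-(δ₁ * (P.mesh j)⁻¹ * (P.mesh 0 * (HiggsLattice.Site.tdist x₁ z : ℝ)))) +
            Real.exp (-(δ₁ * (P.mesh j)⁻¹ * (P.mesh 0 * (HiggsLattice.Site.tdist x₂ z : ℝ))))))
        = maj P k cH (1 - α) δ₁ x₁ z + maj P k cH (1 - α) δ₁ x₂ z := by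
      unfold maj
      rw [← Finset.sum_add_distrib]
      exact Finset.sum_congr rfl fun j _ => by ring
    rw [hsplit] at h
    have h1 : maj P k cH (1 - α) δ₁ x₁ z ≤ M₁ z := maj_rate_mono hcH hrδ x₁ z
    have h2 : maj P k cH (1 - α) δ₁ x₂ z ≤ M₂ z := maj_rate_mono hcH hrδ x₂ z
    have hcol : ∑ i : Ix N, ‖T (cb P N 0 (z, i))‖
        = ∑ i : Ix N, ‖hol C B x₁ Γ (covDeriv C B (propagatorK C Ω B msq a k (cb P N 0 (z, i))) ⟨x₂, μ⟩)
            - covDeriv C B (propagatorK C Ω B msq a k (cb P N 0 (z, i))) ⟨x₁, μ⟩‖ := by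
      simp only [hT', holT_apply]
    calc ∑ i : Ix N, ‖T (cb P N 0 (z, i))‖
        = _ := hcol
      _ ≤ (maj P k cH (1 - α) δ₁ x₁ z + maj P k cH (1 - α) δ₁ x₂ z) * q := h
      _ ≤ (M₁ z + M₂ z) * q := mul_le_mul_of_nonneg_right (add_le_add h1 h2) hq0.le
      _ = q * (M₁ z + M₂ z) := mul_comm _ _
  -- the per-i′ bound
  have hpt : ∀ i' : Ix N,
      ‖holT C B x₁ x₂ Γ μ (propagatorK C Ω B msq a k (srcV C A B k Ω a (W i')))‖
        ≤ q * (maj P k (stepC P N k δJ (1 - α) (2 + (J : ℝ)) cH (cvAt P N C k a Cst s δA δ₁ (P.mesh 0 ^ P.d * Cst) (cK1 P C k Cst s) J) (cdAt P N C k a Cst s δA δ₁ (P.mesh 0 ^ P.d * Cst) (cK1 P C k Cst s) J)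
              (|C.e| * s) ((P.mesh 0)⁻¹ * (|C.e| * δA)) ((|C.e| * s) ^ 2) (kap4 P C k a s))
              ((1 - α) + (2 + (J : ℝ)) - 1) (δJ / 2 / P.L / 2) x₁ x'
          + maj P k (stepC P N k δJ (1 - α) (2 + (J : ℝ)) cH (cvAt P N C k a Cst s δA δ₁ (P.mesh 0 ^ P.d * Cst) (cK1 P C k Cst s) J) (cdAt P N C k a Cst s δA δ₁ (P.mesh 0 ^ P.d * Cst) (cK1 P C k Cst s) J)
              (|C.e| * s) ((P.mesh 0)⁻¹ * (|C.e| * δA)) ((|C.e| * s) ^ 2) (kap4 P C k a s))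
              ((1 - α) + (2 + (J : ℝ)) - 1) (δJ / 2 / P.L / 2) x₂ x') := by
    intro i'
    set w := W i' with hw
    obtain ⟨hVi, hDi⟩ := hW i'
    -- truncated charges and their majorants (everywhere, by `cutV_le_of`/`cutD_le_of`)
    set Vf : HiggsLattice.Site P 0 → ℝ := fun y => cutV k K₀ Ω w y with hVf
    set Df : HiggsLattice.PBond P 0 → ℝ := fun b => cutD k K₀ Ω C B w b with hDf
    have hV : ∀ y, Vf y ≤ maj P k (cvAt P N C k a Cst s δA δ₁ (P.mesh 0 ^ P.d * Cst) (cK1 P C k Cst s) J) (2 + (J : ℝ)) δJ y x' :=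
      fun y => cutV_le_of w (fun z => maj_nonneg hcv0 z x') hVi y
    have hD' : ∀ b, Df b ≤ maj P k (cdAt P N C k a Cst s δA δ₁ (P.mesh 0 ^ P.d * Cst) (cK1 P C k Cst s) J) (2 + (J : ℝ) - 1) δJ b.src x' := by
      intro b
      rw [show (2 : ℝ) + (J : ℝ) - 1 = 1 + (J : ℝ) by ring]
      exact cutD_le_of C B w (fun b' => maj_nonneg hcd0 b'.src x') hDi b
    -- F1's truncated L-form row through T
    have hrow := norm_mapE_srcV_region_le C A B a k (K₀ := K₀) (Ω := Ω) T hkK hs hδA hA hregA hAS w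
    -- the full row at the kernel K, averaging part in `kap4` form
    have hR : ‖holT C B x₁ x₂ Γ μ (propagatorK C Ω B msq a k (srcV C A B k Ω a w))‖
        ≤ (∑ b : HiggsLattice.PBond P 0,
            (|C.e| * s * Df b * K b.tgt
              + ((P.mesh 0)⁻¹ * (|C.e| * δA) * Vf b.src + |C.e| * s * Df b) * K b.src
              + (|C.e| * s) ^ 2 * Vf b.tgt * K b.tgt))
          + kap4 P C k a s * ∑ z : HiggsLattice.Site P 0, K z *
              (((P.L : ℝ) ^ (k * P.d))⁻¹ * ∑ u ∈ blockK k (blockIter k z), Vf u) := by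
      rw [← hT']
      refine hrow.trans (le_of_eq ?_)
      rw [kap4, Finset.mul_sum, Finset.mul_sum]
      congr 1
      exact Finset.sum_congr rfl fun z _ => by ring
    -- split the kernel into the two anchors
    have hsplit := row_le_of_kernel_le_add (k := k) hes hκ₂ (sq_nonneg (|C.e| * s)) hκ₄ K M₁ M₂ hKle
      Vf (fun y => cutV_nonneg w y) Df (fun b => cutD_nonneg C B w b)
    -- each anchor: one step with a_K = 1 − α
    have hstep := fun (p : HiggsLattice.Site P 0) =>
      row_step_le (N := N) hL hk hkK hr0 (hrδ.trans hδ₁1) haK hav hcH hcv0 hcd0 hes hκ₂ (sq_nonneg (|C.e| * s)) hκ₄ i₀ p x'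
        (fun y => maj P k cH (1 - α) δJ p y) (fun y => maj_nonneg hcH p y) (fun y => le_rfl)
        Vf (fun y => cutV_nonneg w y) hV Df (fun b => cutD_nonneg C B w b) hD'
    exact hR.trans (hsplit.trans (mul_le_mul_of_nonneg_left (add_le_add (hstep x₁) (hstep x₂)) hq0.le))
  -- top-scale domination of the two majorants and assembly (verbatim from the torus)
  set cS := stepC P N k δJ (1 - α) (2 + (J : ℝ)) cH (cvAt P N C k a Cst s δA δ₁ (P.mesh 0 ^ P.d * Cst) (cK1 P C k Cst s) J) (cdAt P N C k a Cst s δA δ₁ (P.mesh 0 ^ P.d * Cst) (cK1 P C k Cst s) J)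
    (|C.e| * s) ((P.mesh 0)⁻¹ * (|C.e| * δA)) ((|C.e| * s) ^ 2) (kap4 P C k a s) with hcS
  have hcS0 : 0 ≤ cS := stepC_nonneg hL k hr0 haK hav hcH hcv0 hcd0 hes hκ₂ (sq_nonneg _) hκ₄
  have hsM : 0 < (1 - α) + (2 + (J : ℝ)) - 1 - (P.d : ℝ) := by
    push_cast at hd ⊢; linarith
  set δ' := δJ / 2 / P.L / 2 with hδ'
  have hδ'0 : 0 ≤ δ' := by rw [hδ']; positivity
  have hδ'eq : rateAt P N C k a Cst s δA δ₁ (P.mesh 0 ^ P.d * Cst) (cK1 P C k Cst s) (J + 1) = δ' := by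
    rw [hδ', hδJ]
    exact (seqC_succ (P := P) (N := N) (C := C) (k := k) (a := a) (Cst := Cst) (s := s) (δA := δA) (δ₀ := δ₁)
      (cv₀ := P.mesh 0 ^ P.d * Cst) (cd₀ := cK1 P C k Cst s) J).1
  have htop : ∀ p : HiggsLattice.Site P 0, maj P k cS ((1 - α) + (2 + (J : ℝ)) - 1) δ' p x'
      ≤ cS / ((P.L : ℝ) ^ ((1 - α) + (2 + (J : ℝ)) - 1 - (P.d : ℝ)) - 1) * P.mesh k ^ ((1 - α) + (2 + (J : ℝ)) - 1 - (P.d : ℝ)) *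
          Real.exp (-(δ' * (P.mesh k)⁻¹ * (P.mesh 0 * (HiggsLattice.Site.tdist p x' : ℝ)))) := by
    intro p
    unfold maj
    exact majorant_le_top hL hcS0 hsM hδ'0 p x'
  have hexp : (1 - α) + (2 + (J : ℝ)) - 1 - (P.d : ℝ) = (1 : ℝ) + ((J + 1 : ℕ) : ℝ) - α - (P.d : ℝ) := by push_cast; ring
  have hgeom : 0 < (P.L : ℝ) ^ ((1 : ℝ) + ((J + 1 : ℕ) : ℝ) - α - (P.d : ℝ)) - 1 := by
    have : (1 : ℝ) < (P.L : ℝ) ^ ((1 : ℝ) + ((J + 1 : ℕ) : ℝ) - α - (P.d : ℝ)) := Real.one_lt_rpow hL1' (by rw [← hexp]; exact hsM)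
    linarith
  set Z : ℝ := cS / ((P.L : ℝ) ^ ((1 : ℝ) + ((J + 1 : ℕ) : ℝ) - α - (P.d : ℝ)) - 1) *
    (P.mesh k ^ (J + 1) * (P.mesh k * (P.mesh k ^ P.d)⁻¹ * (P.mesh k ^ α)⁻¹)) with hZ
  have hZ0 : 0 ≤ Z := by
    have := P.mesh_pos k
    rw [hZ]; positivity
  have htop' : ∀ p : HiggsLattice.Site P 0, maj P k cS ((1 - α) + (2 + (J : ℝ)) - 1) δ' p x'
      ≤ Z * Real.exp (-(δ' * ((HiggsLattice.Site.tdist p x' : ℝ) / (P.L : ℝ) ^ k))) := by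
    intro p
    refine (htop p).trans (le_of_eq ?_)
    rw [hexp, mesh_rpow_split_holder, B3Op116DKernelRegularTorus.rate_div_eq, hZ]
  have hLk : (0 : ℝ) < (P.L : ℝ) ^ k := by positivity
  have hsum2 := exp_add_exp_le_two_exp_min hδ'0 hLk (HiggsLattice.Site.tdist x₁ x' : ℝ) (HiggsLattice.Site.tdist x₂ x' : ℝ)
  calc (P.mesh 0 ^ P.d)⁻¹ * ∑ i' : Ix N,
        ‖holT C B x₁ x₂ Γ μ (propagatorK C Ω B msq a k (srcV C A B k Ω a (W i')))‖
      ≤ (P.mesh 0 ^ P.d)⁻¹ * ∑ _i' : Ix N, q * (Z * Real.exp (-(δ' * ((HiggsLattice.Site.tdist x₁ x' : ℝ) / (P.L : ℝ) ^ k)))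
          + Z * Real.exp (-(δ' * ((HiggsLattice.Site.tdist x₂ x' : ℝ) / (P.L : ℝ) ^ k)))) := by
        refine mul_le_mul_of_nonneg_left (Finset.sum_le_sum fun i' _ => (hpt i').trans ?_) hε
        exact mul_le_mul_of_nonneg_left (add_le_add (htop' x₁) (htop' x₂)) hq0.le
    _ = q * ((P.mesh 0 ^ P.d)⁻¹ * (Fintype.card (Ix N) : ℝ) * Z) *
          (Real.exp (-(δ' * ((HiggsLattice.Site.tdist x₁ x' : ℝ) / (P.L : ℝ) ^ k)))
            + Real.exp (-(δ' * ((HiggsLattice.Site.tdist x₂ x' : ℝ) / (P.L : ℝ) ^ k)))) := by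
        rw [Finset.sum_const, Finset.card_univ, nsmul_eq_mul]; ring
    _ ≤ q * ((P.mesh 0 ^ P.d)⁻¹ * (Fintype.card (Ix N) : ℝ) * Z) *
          (2 * Real.exp (-(δ' * (min (HiggsLattice.Site.tdist x₁ x' : ℝ) (HiggsLattice.Site.tdist x₂ x' : ℝ) / (P.L : ℝ) ^ k)))) :=
        mul_le_mul_of_nonneg_left hsum2 (by positivity)
    _ = _ := by
        rw [hδ'eq, holC, hZ, hq]
        ring

end Row

/-! ## §2 The (I.3.44) split of `(1.16)_{0,n′+1}` on a region (field identity, every `Ω`) -/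

section Split

variable {C : ChargeData N} {Ω : Finset (HiggsLattice.Site P 0)} {A B : HiggsLattice.VecField P 0} {msq a : ℝ} {k : ℕ}

/- v1.1: the identity `W_apply_eq_op116_one_zero_region` ((I.3.44) read from the left on a region) of v1.0 is p40's
`B3Op116DKernelRegularRegion.W_apply_eq_op116_one_zero_region` (landed first, p361276); v1.1 imports and uses it (dedup). -/

/-- **THE SPLIT ON A REGION**: `(1.16)_{0,n′+1}φ = G_k(Ω,B̃)V_k·[G_k(Ω,B̃)(V_kG_k(Ω,B̃))^{n′}φ] + (1.16)_{1,n′+1}φ` (the region twin of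
`B3Op116HolderKernelRegularTorusZero.op116_zero_succ_split`; `m² > 0`, `a > 0`, `k ≥ 1`, `L > 1`).
[cite: Balaban1982Higgs1, (3.44) p.619] [cite: Balaban1983Higgs3, (1.16) p.414] -/
theorem op116_zero_succ_split_region (hL : 1 < P.L) (hmsq : 0 < msq) (ha : 0 < a) (hk : 1 ≤ k) (n' : ℕ) (φ : ScalarField P 0 N) :
    op116 C Ω A B msq a k 0 (n' + 1) φ
      = propagatorK C Ω B msq a k (srcV C A B k Ω a
          (propagatorK C Ω B msq a k ((fun ψ => srcV C A B k Ω a (propagatorK C Ω B msq a k ψ))^[n'] φ)))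
        + op116 C Ω A B msq a k 1 (n' + 1) φ := by
  set f : ScalarField P 0 N → ScalarField P 0 N := fun ψ => srcV C A B k Ω a (propagatorK C Ω B msq a k ψ) with hf
  have h0 : op116 C Ω A B msq a k 0 (n' + 1) φ = propagatorK C Ω (A + B) msq a k (f^[n' + 1] φ) := by
    rw [B3Op116HolderKernelRegularTorusZero.op116_eq_iterate, op116_zero_zero_apply]
  have h1 : op116 C Ω A B msq a k 1 (n' + 1) φ = op116 C Ω A B msq a k 1 0 (f^[n' + 1] φ) := by
    rw [B3Op116HolderKernelRegularTorusZero.op116_eq_iterate]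
  have hW := B3Op116DKernelRegularRegion.W_apply_eq_op116_one_zero_region (C := C) (Ω := Ω) (A := A) (B := B) (msq := msq)
    (a := a) (k := k) hL hmsq ha hk
    (f^[n' + 1] φ)
  rw [LinearMap.sub_apply] at hW
  have hsucc : f^[n' + 1] φ = f (f^[n'] φ) := Function.iterate_succ_apply' f n' φ
  rw [h0, h1, ← hW]
  have hG : propagatorK C Ω B msq a k (f^[n' + 1] φ) = propagatorK C Ω B msq a k (srcV C A B k Ω a (propagatorK C Ω B msq a k (f^[n'] φ))) := by
    rw [hsucc]
  rw [← hG]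
  abel

end Split

/-! ## §3 The Hölder binders of the kernel of (1.16) on a region, from the region states of the inner fields -/

section Kernel

variable {C : ChargeData N} {A B : HiggsLattice.VecField P 0} {msq a : ℝ} {k K₀ : ℕ} {Ω : Finset (HiggsLattice.Site P 0)}
  {δ₁ Cst s δA α cH : ℝ}

variable (hδ₁ : 0 < δ₁) (hδ₁1 : δ₁ ≤ 1) (hCst : 0 ≤ Cst)
  (hk : 1 ≤ k) (hkK : k ≤ P.K) (i₀ : Ix N)
  (hs : 0 ≤ s) (hA : ∀ b : HiggsLattice.PBond P 0, |A b| ≤ s) (hδA : 0 ≤ δA)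
  (hregA : ∀ (z : HiggsLattice.Site P 0) (μ ν : Fin P.d), |A ⟨z.shift ν, μ⟩ - A ⟨z, μ⟩| ≤ δA)
  (hAS : ∀ b : HiggsLattice.PBond P 0, A b ≠ 0 → DeepBlk k K₀ Ω b.src ∧ DeepBlk k K₀ Ω b.tgt)
  (hα1 : α < 1) (hcH : 0 ≤ cH)
  (h211 : ∀ (μ : Fin P.d) (x₁ x₂ y : HiggsLattice.Site P 0), Interior k K₀ Ω x₁ → Interior k K₀ Ω x₂ → Interior k K₀ Ω y →
    x₁ ≠ x₂ → ∀ Γ : List (HiggsLattice.Site P 0), IsAdm x₁ x₂ Γ →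
    (∑ i : Ix N, ‖hol C B x₁ Γ (covDeriv C B (propagatorK C Ω B msq a k (cb P N 0 (y, i))) ⟨x₂, μ⟩)
        - covDeriv C B (propagatorK C Ω B msq a k (cb P N 0 (y, i))) ⟨x₁, μ⟩‖)
        / (P.mesh 0 * (HiggsLattice.Site.tdist x₁ x₂ : ℝ)) ^ α
      ≤ ∑ j ∈ Finset.range k, cH * P.mesh j ^ (((1 : ℝ) - α) - (P.d : ℝ)) *
          (Real.exp (-(δ₁ * (P.mesh j)⁻¹ * (P.mesh 0 * (HiggsLattice.Site.tdist x₁ y : ℝ)))) +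
            Real.exp (-(δ₁ * (P.mesh j)⁻¹ * (P.mesh 0 * (HiggsLattice.Site.tdist x₂ y : ℝ))))))
include hδ₁ hδ₁1 hCst hk hkK i₀ hs hA hδA hregA hAS hα1 hcH h211

/-- **THE HÖLDER QUOTIENT OF THE ROW DERIVATIVE OF THE KERNEL OF (1.16) ON A REGION, `n = m+1 ≥ 1`, FROM THE REGION STATE OF THE INNER
FIELDS** (the region twin of `B3Op116HolderKernelRegularTorus.kernel116_holder_le`; print p. 414 *"the Hölder norms of the covariant
derivatives of this kernel … are exponentially decaying … uniformly bounded by O(1)(e(L^kε)^{1−α})^{n+n′}"*): if the inner fields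
`(1.16)^Ω_{m,n′}e_{(x′,i′)}` are in FILE 4β₂'s state `m+n′` AT INTERIOR POINTS (p40's F2 `B3Op116DKernelRegularRegion` produces this), then for
interior `x₁ ≠ x₂`, every `x′`, admissible `Γ` and `d < 1 + (m+1+n′) − α`:
`ε^{−d}Σ_{i′}‖U(B̃(Γ))(D^ε_{B̃}(1.16)^Ω_{m+1,n′}e_{(x′,i′)})(⟨x₂,μ⟩) − (D^ε_{B̃}(1.16)^Ω_{m+1,n′}e_{(x′,i′)})(⟨x₁,μ⟩)‖
≤ (ε|x₁−x₂|)^α·holC(m+n′)·(L^kε)^{m+n′+1}·((L^kε)((L^kε)^d)^{−1}((L^kε)^α)^{−1})·exp(−δ_{m+n′+1}·min(|x₁−x′|,|x₂−x′|)/L^k)` — the torus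
constant and rate. [cite: Balaban1983Higgs3, (1.16) p.414, p.412, (2.5) p.424, (2.11) p.426] [cite: Balaban1982Higgs1, Prop. 2.1 (2.24) p.610] -/
theorem kernel116_holder_le_region_of_state (hL : 1 < P.L) (m n' : ℕ) (hd : (P.d : ℝ) < 1 + ((m + 1 + n' : ℕ) : ℝ) - α) (μ : Fin P.d)
    (x₁ x₂ x' : HiggsLattice.Site P 0) (hx₁ : Interior k K₀ Ω x₁) (hx₂ : Interior k K₀ Ω x₂) (hne : x₁ ≠ x₂)
    (Γ : List (HiggsLattice.Site P 0)) (hΓ : IsAdm x₁ x₂ Γ)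
    (hst : ∀ i' : Ix N,
      (∀ y, Interior k K₀ Ω y → ‖op116 C Ω A B msq a k m n' (cb P N 0 (x', i')) y‖
          ≤ maj P k (cvAt P N C k a Cst s δA δ₁ (P.mesh 0 ^ P.d * Cst) (cK1 P C k Cst s) (m + n')) (2 + ((m + n' : ℕ) : ℝ))
            (rateAt P N C k a Cst s δA δ₁ (P.mesh 0 ^ P.d * Cst) (cK1 P C k Cst s) (m + n')) y x') ∧
      (∀ b, Interior k K₀ Ω b.src → ‖covDeriv C B (op116 C Ω A B msq a k m n' (cb P N 0 (x', i'))) b‖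
          ≤ maj P k (cdAt P N C k a Cst s δA δ₁ (P.mesh 0 ^ P.d * Cst) (cK1 P C k Cst s) (m + n')) (1 + ((m + n' : ℕ) : ℝ))
            (rateAt P N C k a Cst s δA δ₁ (P.mesh 0 ^ P.d * Cst) (cK1 P C k Cst s) (m + n')) b.src x')) :
    (P.mesh 0 ^ P.d)⁻¹ * ∑ i' : Ix N,
        ‖hol C B x₁ Γ (covDeriv C B (op116 C Ω A B msq a k (m + 1) n' (cb P N 0 (x', i'))) ⟨x₂, μ⟩)
          - covDeriv C B (op116 C Ω A B msq a k (m + 1) n' (cb P N 0 (x', i'))) ⟨x₁, μ⟩‖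
      ≤ (P.mesh 0 * (HiggsLattice.Site.tdist x₁ x₂ : ℝ)) ^ α *
          (holC P N C k a δ₁ Cst s δA α cH (m + n') * P.mesh k ^ (m + n' + 1) *
            (P.mesh k * (P.mesh k ^ P.d)⁻¹ * (P.mesh k ^ α)⁻¹)) *
          Real.exp (-(rateAt P N C k a Cst s δA δ₁ (P.mesh 0 ^ P.d * Cst) (cK1 P C k Cst s) (m + n' + 1) *
            (min (HiggsLattice.Site.tdist x₁ x' : ℝ) (HiggsLattice.Site.tdist x₂ x' : ℝ) / (P.L : ℝ) ^ k))) := by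
  have hd' : (P.d : ℝ) < 1 + ((m + n' + 1 : ℕ) : ℝ) - α := by push_cast at hd ⊢; linarith
  have h := holder_row_family_le_region hδ₁ hδ₁1 hCst hk hkK i₀ hs hA hδA hregA hAS hα1 hcH h211 hL (m + n') hd' μ x₁ x₂ x' hx₁ hx₂
    hne Γ hΓ (fun i' => op116 C Ω A B msq a k m n' (cb P N 0 (x', i'))) hst
  simp only [op116_succ_left_apply, ← holT_apply]
  exact h

/-- **THE HÖLDER QUOTIENT AT `n = 0`, `n′+1 ≥ 1`, ON A REGION, FROM THE REGION STATES** (the region twin of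
`B3Op116HolderKernelRegularTorusZero.kernel116_holder_le_zero_left`): if the pure-`B̃` chain `G_k(Ω,B̃)(V_kG_k(Ω,B̃))^{n′}e_{(x′,i′)}` is in
the state `n′` and `(1.16)^Ω_{0,n′+1}e_{(x′,i′)}` is in the state `n′+1`, both AT INTERIOR POINTS (p40's F2), then for interior `x₁ ≠ x₂`,
every `x′`, admissible `Γ` and `d < 1 + (n′+1) − α`:
`ε^{−d}Σ_{i′}‖U(B̃(Γ))(D^ε_{B̃}(1.16)^Ω_{0,n′+1}e_{(x′,i′)})(⟨x₂,μ⟩) − (…)(⟨x₁,μ⟩)‖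
≤ (ε|x₁−x₂|)^α·[holC(n′)(L^kε)^{n′+1} + holC(n′+1)(L^kε)^{n′+2}]·((L^kε)((L^kε)^d)^{−1}((L^kε)^α)^{−1})·exp(−δ_{n′+2}·min(|x₁−x′|,|x₂−x′|)/L^k)`
— the (I.3.44) split of §2, §1 at `J = n′` for the chain term and `kernel116_holder_le_region_of_state` at `(0+1, n′+1)` for the other.
[cite: Balaban1983Higgs3, (1.16) p.414, p.412, (2.5) p.424, (2.11) p.426] [cite: Balaban1982Higgs1, Prop. 2.1 (2.24) p.610, (3.44) p.619] -/
theorem kernel116_holder_le_zero_left_region_of_state (hL : 1 < P.L) (hmsq : 0 < msq) (ha : 0 < a) (n' : ℕ)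
    (hd : (P.d : ℝ) < 1 + ((n' + 1 : ℕ) : ℝ) - α) (μ : Fin P.d)
    (x₁ x₂ x' : HiggsLattice.Site P 0) (hx₁ : Interior k K₀ Ω x₁) (hx₂ : Interior k K₀ Ω x₂) (hne : x₁ ≠ x₂)
    (Γ : List (HiggsLattice.Site P 0)) (hΓ : IsAdm x₁ x₂ Γ)
    (hchain : ∀ i' : Ix N,
      (∀ y, Interior k K₀ Ω y → ‖propagatorK C Ω B msq a k
            ((fun ψ => srcV C A B k Ω a (propagatorK C Ω B msq a k ψ))^[n'] (cb P N 0 (x', i'))) y‖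
          ≤ maj P k (cvAt P N C k a Cst s δA δ₁ (P.mesh 0 ^ P.d * Cst) (cK1 P C k Cst s) n') (2 + (n' : ℝ))
            (rateAt P N C k a Cst s δA δ₁ (P.mesh 0 ^ P.d * Cst) (cK1 P C k Cst s) n') y x') ∧
      (∀ b, Interior k K₀ Ω b.src → ‖covDeriv C B (propagatorK C Ω B msq a k
            ((fun ψ => srcV C A B k Ω a (propagatorK C Ω B msq a k ψ))^[n'] (cb P N 0 (x', i')))) b‖
          ≤ maj P k (cdAt P N C k a Cst s δA δ₁ (P.mesh 0 ^ P.d * Cst) (cK1 P C k Cst s) n') (1 + (n' : ℝ))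
            (rateAt P N C k a Cst s δA δ₁ (P.mesh 0 ^ P.d * Cst) (cK1 P C k Cst s) n') b.src x'))
    (hst : ∀ i' : Ix N,
      (∀ y, Interior k K₀ Ω y → ‖op116 C Ω A B msq a k 0 (n' + 1) (cb P N 0 (x', i')) y‖
          ≤ maj P k (cvAt P N C k a Cst s δA δ₁ (P.mesh 0 ^ P.d * Cst) (cK1 P C k Cst s) (0 + (n' + 1))) (2 + ((0 + (n' + 1) : ℕ) : ℝ))
            (rateAt P N C k a Cst s δA δ₁ (P.mesh 0 ^ P.d * Cst) (cK1 P C k Cst s) (0 + (n' + 1))) y x') ∧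
      (∀ b, Interior k K₀ Ω b.src → ‖covDeriv C B (op116 C Ω A B msq a k 0 (n' + 1) (cb P N 0 (x', i'))) b‖
          ≤ maj P k (cdAt P N C k a Cst s δA δ₁ (P.mesh 0 ^ P.d * Cst) (cK1 P C k Cst s) (0 + (n' + 1))) (1 + ((0 + (n' + 1) : ℕ) : ℝ))
            (rateAt P N C k a Cst s δA δ₁ (P.mesh 0 ^ P.d * Cst) (cK1 P C k Cst s) (0 + (n' + 1))) b.src x')) :
    (P.mesh 0 ^ P.d)⁻¹ * ∑ i' : Ix N,
        ‖hol C B x₁ Γ (covDeriv C B (op116 C Ω A B msq a k 0 (n' + 1) (cb P N 0 (x', i'))) ⟨x₂, μ⟩)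
          - covDeriv C B (op116 C Ω A B msq a k 0 (n' + 1) (cb P N 0 (x', i'))) ⟨x₁, μ⟩‖
      ≤ (P.mesh 0 * (HiggsLattice.Site.tdist x₁ x₂ : ℝ)) ^ α *
          ((holC P N C k a δ₁ Cst s δA α cH n' * P.mesh k ^ (n' + 1)
              + holC P N C k a δ₁ Cst s δA α cH (n' + 1) * P.mesh k ^ (n' + 2)) *
            (P.mesh k * (P.mesh k ^ P.d)⁻¹ * (P.mesh k ^ α)⁻¹)) *
          Real.exp (-(rateAt P N C k a Cst s δA δ₁ (P.mesh 0 ^ P.d * Cst) (cK1 P C k Cst s) (n' + 2) *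
            (min (HiggsLattice.Site.tdist x₁ x' : ℝ) (HiggsLattice.Site.tdist x₂ x' : ℝ) / (P.L : ℝ) ^ k))) := by
  have hε : 0 ≤ (P.mesh 0 ^ P.d)⁻¹ := inv_nonneg.mpr (pow_nonneg (P.mesh_pos 0).le _)
  have hc : 0 ≤ P.mesh 0 ^ P.d * Cst := mul_nonneg (pow_nonneg (P.mesh_pos 0).le _) hCst
  obtain ⟨-, hcK1⟩ := cK1_ge (P := P) (C := C) (k := k) hCst hs
  -- abbreviations
  set S : ℝ := P.mesh k * (P.mesh k ^ P.d)⁻¹ * (P.mesh k ^ α)⁻¹ with hS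
  set q : ℝ := (P.mesh 0 * (HiggsLattice.Site.tdist x₁ x₂ : ℝ)) ^ α with hq
  set mn : ℝ := min (HiggsLattice.Site.tdist x₁ x' : ℝ) (HiggsLattice.Site.tdist x₂ x' : ℝ) / (P.L : ℝ) ^ k with hmn
  have hq0 : 0 ≤ q := by rw [hq]; exact Real.rpow_nonneg (mul_nonneg (P.mesh_pos 0).le (Nat.cast_nonneg _)) α
  have hS0 : 0 ≤ S := by have := P.mesh_pos k; rw [hS]; positivity
  have hmn0 : 0 ≤ mn := by
    rw [hmn]; exact div_nonneg (le_min (Nat.cast_nonneg _) (Nat.cast_nonneg _)) (pow_nonneg (Nat.cast_nonneg _) _)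
  -- the inner family of the chain term
  set f : ScalarField P 0 N → ScalarField P 0 N := fun ψ => srcV C A B k Ω a (propagatorK C Ω B msq a k ψ) with hf
  set W : Ix N → ScalarField P 0 N := fun i' => propagatorK C Ω B msq a k (f^[n'] (cb P N 0 (x', i'))) with hW
  -- term 1: the chain through §1
  have h1 := holder_row_family_le_region hδ₁ hδ₁1 hCst hk hkK i₀ hs hA hδA hregA hAS hα1 hcH h211 hL n' hd μ x₁ x₂ x' hx₁ hx₂ hne Γ hΓ
    W hchain
  -- term 2: §3's first theorem at (0+1, n′+1)
  have hd2 : (P.d : ℝ) < 1 + ((0 + 1 + (n' + 1) : ℕ) : ℝ) - α := by push_cast at hd ⊢; linarith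
  have h2 := kernel116_holder_le_region_of_state hδ₁ hδ₁1 hCst hk hkK i₀ hs hA hδA hregA hAS hα1 hcH h211 hL 0 (n' + 1) hd2 μ
    x₁ x₂ x' hx₁ hx₂ hne Γ hΓ hst
  have e1 : 0 + (n' + 1) = n' + 1 := by omega
  simp only [e1] at h2
  -- rates: δ_{n′+2} ≤ δ_{n′+1}
  have hrate : rateAt P N C k a Cst s δA δ₁ (P.mesh 0 ^ P.d * Cst) (cK1 P C k Cst s) (n' + 2)
      ≤ rateAt P N C k a Cst s δA δ₁ (P.mesh 0 ^ P.d * Cst) (cK1 P C k Cst s) (n' + 1) := by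
    obtain ⟨hr0, -, -, -⟩ := seqC_pos (P := P) (N := N) (C := C) (k := k) (a := a) (Cst := Cst) (s := s) (δA := δA)
      (δ₀ := δ₁) (cv₀ := P.mesh 0 ^ P.d * Cst) (cd₀ := cK1 P C k Cst s) hL hδ₁ le_rfl hc hcK1 hCst hs hδA (n' + 1)
    rw [show n' + 2 = (n' + 1) + 1 by omega,
      (seqC_succ (P := P) (N := N) (C := C) (k := k) (a := a) (Cst := Cst) (s := s) (δA := δA) (δ₀ := δ₁)
        (cv₀ := P.mesh 0 ^ P.d * Cst) (cd₀ := cK1 P C k Cst s) (n' + 1)).1]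
    have hL1r : (1 : ℝ) ≤ (P.L : ℝ) := by exact_mod_cast P.hL
    rw [div_div, div_div, div_le_iff₀ (by positivity)]
    nlinarith
  have hexp : Real.exp (-(rateAt P N C k a Cst s δA δ₁ (P.mesh 0 ^ P.d * Cst) (cK1 P C k Cst s) (n' + 1) * mn))
      ≤ Real.exp (-(rateAt P N C k a Cst s δA δ₁ (P.mesh 0 ^ P.d * Cst) (cK1 P C k Cst s) (n' + 2) * mn)) := by
    apply Real.exp_le_exp.mpr
    nlinarith
  -- the split, pointwise in i′
  have hsplit : ∀ i' : Ix N,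
      ‖hol C B x₁ Γ (covDeriv C B (op116 C Ω A B msq a k 0 (n' + 1) (cb P N 0 (x', i'))) ⟨x₂, μ⟩)
          - covDeriv C B (op116 C Ω A B msq a k 0 (n' + 1) (cb P N 0 (x', i'))) ⟨x₁, μ⟩‖
        ≤ ‖holT C B x₁ x₂ Γ μ (propagatorK C Ω B msq a k (srcV C A B k Ω a (W i')))‖
          + ‖hol C B x₁ Γ (covDeriv C B (op116 C Ω A B msq a k 1 (n' + 1) (cb P N 0 (x', i'))) ⟨x₂, μ⟩)
              - covDeriv C B (op116 C Ω A B msq a k 1 (n' + 1) (cb P N 0 (x', i'))) ⟨x₁, μ⟩‖ := by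
    intro i'
    rw [← holT_apply, ← holT_apply, op116_zero_succ_split_region hL hmsq ha hk n' (cb P N 0 (x', i')), map_add]
    have hWi : propagatorK C Ω B msq a k (srcV C A B k Ω a (propagatorK C Ω B msq a k (f^[n'] (cb P N 0 (x', i'))))) =
        propagatorK C Ω B msq a k (srcV C A B k Ω a (W i')) := rfl
    rw [hWi]
    exact norm_add_le _ _
  -- assembly
  have hsum := Finset.sum_le_sum fun i' (_ : i' ∈ (Finset.univ : Finset (Ix N))) => hsplit i'
  rw [Finset.sum_add_distrib] at hsum
  have hA1 : q * (holC P N C k a δ₁ Cst s δA α cH n' * P.mesh k ^ (n' + 1) * S) *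
        Real.exp (-(rateAt P N C k a Cst s δA δ₁ (P.mesh 0 ^ P.d * Cst) (cK1 P C k Cst s) (n' + 1) * mn))
      ≤ q * (holC P N C k a δ₁ Cst s δA α cH n' * P.mesh k ^ (n' + 1) * S) *
        Real.exp (-(rateAt P N C k a Cst s δA δ₁ (P.mesh 0 ^ P.d * Cst) (cK1 P C k Cst s) (n' + 2) * mn)) := by
    have hC1 : 0 ≤ holC P N C k a δ₁ Cst s δA α cH n' :=
      B3Op116HolderKernelRegularTorus.holC_nonneg hL hδ₁ hCst hs hδA hα1 hcH n' hd
    have : 0 ≤ q * (holC P N C k a δ₁ Cst s δA α cH n' * P.mesh k ^ (n' + 1) * S) := by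
      have := P.mesh_pos k; positivity
    exact mul_le_mul_of_nonneg_left hexp this
  calc (P.mesh 0 ^ P.d)⁻¹ * ∑ i' : Ix N,
        ‖hol C B x₁ Γ (covDeriv C B (op116 C Ω A B msq a k 0 (n' + 1) (cb P N 0 (x', i'))) ⟨x₂, μ⟩)
          - covDeriv C B (op116 C Ω A B msq a k 0 (n' + 1) (cb P N 0 (x', i'))) ⟨x₁, μ⟩‖
      ≤ (P.mesh 0 ^ P.d)⁻¹ * ((∑ i' : Ix N, ‖holT C B x₁ x₂ Γ μ (propagatorK C Ω B msq a k (srcV C A B k Ω a (W i')))‖)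
          + ∑ i' : Ix N, ‖hol C B x₁ Γ (covDeriv C B (op116 C Ω A B msq a k 1 (n' + 1) (cb P N 0 (x', i'))) ⟨x₂, μ⟩)
              - covDeriv C B (op116 C Ω A B msq a k 1 (n' + 1) (cb P N 0 (x', i'))) ⟨x₁, μ⟩‖) :=
        mul_le_mul_of_nonneg_left hsum hε
    _ = (P.mesh 0 ^ P.d)⁻¹ * ∑ i' : Ix N, ‖holT C B x₁ x₂ Γ μ (propagatorK C Ω B msq a k (srcV C A B k Ω a (W i')))‖
          + (P.mesh 0 ^ P.d)⁻¹ * ∑ i' : Ix N,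
            ‖hol C B x₁ Γ (covDeriv C B (op116 C Ω A B msq a k 1 (n' + 1) (cb P N 0 (x', i'))) ⟨x₂, μ⟩)
              - covDeriv C B (op116 C Ω A B msq a k 1 (n' + 1) (cb P N 0 (x', i'))) ⟨x₁, μ⟩‖ := mul_add _ _ _
    _ ≤ q * (holC P N C k a δ₁ Cst s δA α cH n' * P.mesh k ^ (n' + 1) * S) *
          Real.exp (-(rateAt P N C k a Cst s δA δ₁ (P.mesh 0 ^ P.d * Cst) (cK1 P C k Cst s) (n' + 1) * mn))
        + q * (holC P N C k a δ₁ Cst s δA α cH (n' + 1) * P.mesh k ^ (n' + 2) * S) *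
          Real.exp (-(rateAt P N C k a Cst s δA δ₁ (P.mesh 0 ^ P.d * Cst) (cK1 P C k Cst s) (n' + 2) * mn)) :=
        add_le_add h1 h2
    _ ≤ q * (holC P N C k a δ₁ Cst s δA α cH n' * P.mesh k ^ (n' + 1) * S) *
          Real.exp (-(rateAt P N C k a Cst s δA δ₁ (P.mesh 0 ^ P.d * Cst) (cK1 P C k Cst s) (n' + 2) * mn))
        + q * (holC P N C k a δ₁ Cst s δA α cH (n' + 1) * P.mesh k ^ (n' + 2) * S) *
          Real.exp (-(rateAt P N C k a Cst s δA δ₁ (P.mesh 0 ^ P.d * Cst) (cK1 P C k Cst s) (n' + 2) * mn)) :=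
        add_le_add hA1 le_rfl
    _ = _ := by ring

/-- **PACKAGED FORM at `(0, n′+1)`** (p40's binder `hH`; `L^kε ≤ 1`): one constant `(holC(n′) + holC(n′+1))·(L^kε)^{n′+1}` and the rate
`δ_{n′+2}` — the region twin of `B3Op116HolderKernelRegularTorusZero.kernel116_holder_le_zero_left'`.
[cite: Balaban1983Higgs3, (1.16) p.414, p.412, (2.5) p.424, (2.11) p.426] -/
theorem kernel116_holder_le_zero_left_region_of_state' (hL : 1 < P.L) (hmsq : 0 < msq) (ha : 0 < a) (hmesh : P.mesh k ≤ 1) (n' : ℕ)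
    (hd : (P.d : ℝ) < 1 + ((n' + 1 : ℕ) : ℝ) - α) (μ : Fin P.d)
    (x₁ x₂ x' : HiggsLattice.Site P 0) (hx₁ : Interior k K₀ Ω x₁) (hx₂ : Interior k K₀ Ω x₂) (hne : x₁ ≠ x₂)
    (Γ : List (HiggsLattice.Site P 0)) (hΓ : IsAdm x₁ x₂ Γ)
    (hchain : ∀ i' : Ix N,
      (∀ y, Interior k K₀ Ω y → ‖propagatorK C Ω B msq a k
            ((fun ψ => srcV C A B k Ω a (propagatorK C Ω B msq a k ψ))^[n'] (cb P N 0 (x', i'))) y‖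
          ≤ maj P k (cvAt P N C k a Cst s δA δ₁ (P.mesh 0 ^ P.d * Cst) (cK1 P C k Cst s) n') (2 + (n' : ℝ))
            (rateAt P N C k a Cst s δA δ₁ (P.mesh 0 ^ P.d * Cst) (cK1 P C k Cst s) n') y x') ∧
      (∀ b, Interior k K₀ Ω b.src → ‖covDeriv C B (propagatorK C Ω B msq a k
            ((fun ψ => srcV C A B k Ω a (propagatorK C Ω B msq a k ψ))^[n'] (cb P N 0 (x', i')))) b‖
          ≤ maj P k (cdAt P N C k a Cst s δA δ₁ (P.mesh 0 ^ P.d * Cst) (cK1 P C k Cst s) n') (1 + (n' : ℝ))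
            (rateAt P N C k a Cst s δA δ₁ (P.mesh 0 ^ P.d * Cst) (cK1 P C k Cst s) n') b.src x'))
    (hst : ∀ i' : Ix N,
      (∀ y, Interior k K₀ Ω y → ‖op116 C Ω A B msq a k 0 (n' + 1) (cb P N 0 (x', i')) y‖
          ≤ maj P k (cvAt P N C k a Cst s δA δ₁ (P.mesh 0 ^ P.d * Cst) (cK1 P C k Cst s) (0 + (n' + 1))) (2 + ((0 + (n' + 1) : ℕ) : ℝ))
            (rateAt P N C k a Cst s δA δ₁ (P.mesh 0 ^ P.d * Cst) (cK1 P C k Cst s) (0 + (n' + 1))) y x') ∧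
      (∀ b, Interior k K₀ Ω b.src → ‖covDeriv C B (op116 C Ω A B msq a k 0 (n' + 1) (cb P N 0 (x', i'))) b‖
          ≤ maj P k (cdAt P N C k a Cst s δA δ₁ (P.mesh 0 ^ P.d * Cst) (cK1 P C k Cst s) (0 + (n' + 1))) (1 + ((0 + (n' + 1) : ℕ) : ℝ))
            (rateAt P N C k a Cst s δA δ₁ (P.mesh 0 ^ P.d * Cst) (cK1 P C k Cst s) (0 + (n' + 1))) b.src x')) :
    (P.mesh 0 ^ P.d)⁻¹ * ∑ i' : Ix N,
        ‖hol C B x₁ Γ (covDeriv C B (op116 C Ω A B msq a k 0 (n' + 1) (cb P N 0 (x', i'))) ⟨x₂, μ⟩)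
          - covDeriv C B (op116 C Ω A B msq a k 0 (n' + 1) (cb P N 0 (x', i'))) ⟨x₁, μ⟩‖
      ≤ (P.mesh 0 * (HiggsLattice.Site.tdist x₁ x₂ : ℝ)) ^ α *
          ((holC P N C k a δ₁ Cst s δA α cH n' + holC P N C k a δ₁ Cst s δA α cH (n' + 1)) * P.mesh k ^ (n' + 1) *
            (P.mesh k * (P.mesh k ^ P.d)⁻¹ * (P.mesh k ^ α)⁻¹)) *
          Real.exp (-(rateAt P N C k a Cst s δA δ₁ (P.mesh 0 ^ P.d * Cst) (cK1 P C k Cst s) (n' + 2) *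
            (min (HiggsLattice.Site.tdist x₁ x' : ℝ) (HiggsLattice.Site.tdist x₂ x' : ℝ) / (P.L : ℝ) ^ k))) := by
  have h := kernel116_holder_le_zero_left_region_of_state hδ₁ hδ₁1 hCst hk hkK i₀ hs hA hδA hregA hAS hα1 hcH h211 hL hmsq ha n' hd μ
    x₁ x₂ x' hx₁ hx₂ hne Γ hΓ hchain hst
  refine h.trans ?_
  have hm0 : 0 < P.mesh k := P.mesh_pos k
  have hd' : (P.d : ℝ) < 1 + ((n' + 1 + 1 : ℕ) : ℝ) - α := by push_cast at hd ⊢; linarith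
  have hC0 : 0 ≤ holC P N C k a δ₁ Cst s δA α cH n' := B3Op116HolderKernelRegularTorus.holC_nonneg hL hδ₁ hCst hs hδA hα1 hcH n' hd
  have hC1 : 0 ≤ holC P N C k a δ₁ Cst s δA α cH (n' + 1) :=
    B3Op116HolderKernelRegularTorus.holC_nonneg hL hδ₁ hCst hs hδA hα1 hcH (n' + 1) hd'
  have hpow : P.mesh k ^ (n' + 2) ≤ P.mesh k ^ (n' + 1) := pow_le_pow_of_le_one hm0.le hmesh (by omega)
  have hkey : holC P N C k a δ₁ Cst s δA α cH n' * P.mesh k ^ (n' + 1)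
        + holC P N C k a δ₁ Cst s δA α cH (n' + 1) * P.mesh k ^ (n' + 2)
      ≤ (holC P N C k a δ₁ Cst s δA α cH n' + holC P N C k a δ₁ Cst s δA α cH (n' + 1)) * P.mesh k ^ (n' + 1) := by
    rw [add_mul]
    exact add_le_add le_rfl (mul_le_mul_of_nonneg_left hpow hC1)
  have hq0 : 0 ≤ (P.mesh 0 * (HiggsLattice.Site.tdist x₁ x₂ : ℝ)) ^ α :=
    Real.rpow_nonneg (mul_nonneg (P.mesh_pos 0).le (Nat.cast_nonneg _)) α
  have hS0 : 0 ≤ P.mesh k * (P.mesh k ^ P.d)⁻¹ * (P.mesh k ^ α)⁻¹ := by positivity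
  exact mul_le_mul_of_nonneg_right (mul_le_mul_of_nonneg_left (mul_le_mul_of_nonneg_right hkey hS0) hq0) (Real.exp_pos _).le

end Kernel

/-! ## §4 (v1.1) The closed Hölder binders on a region: §3 fed with p40's F2 region states -/

section Closed

open B3Ineq210RegularRegion (regRegionKernels)
open B3Op116DKernelRegularRegion (state_op116_cb_region state_chainB_region base_state_region)

variable {C : ChargeData N} {A B : HiggsLattice.VecField P 0} {msq a : ℝ} {k K₀ : ℕ} {hL1 : 1 < P.L} {Ω : Finset (HiggsLattice.Site P 0)}
  {δ₁ Cst s δA α cH : ℝ}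

variable (hδ₁ : 0 < δ₁) (hδ₁1 : δ₁ ≤ 1) (hCst : 0 ≤ Cst)
  (h210B : (regRegionKernels hL1 C Ω B msq a k K₀).Ineq210 δ₁ Cst)
  (h210AB : (regRegionKernels hL1 C Ω (A + B) msq a k K₀).Ineq210 δ₁ Cst)
  (hmsq : 0 < msq) (ha : 0 < a) (hk : 1 ≤ k) (hkK : k ≤ P.K) (i₀ : Ix N)
  (hs : 0 ≤ s) (hA : ∀ b : HiggsLattice.PBond P 0, |A b| ≤ s) (hδA : 0 ≤ δA)
  (hregA : ∀ (z : HiggsLattice.Site P 0) (μ ν : Fin P.d), |A ⟨z.shift ν, μ⟩ - A ⟨z, μ⟩| ≤ δA)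
  (hAS : ∀ b : HiggsLattice.PBond P 0, A b ≠ 0 → DeepBlk k K₀ Ω b.src ∧ DeepBlk k K₀ Ω b.tgt)
  (hα1 : α < 1) (hcH : 0 ≤ cH)
  (h211 : ∀ (μ : Fin P.d) (x₁ x₂ y : HiggsLattice.Site P 0), Interior k K₀ Ω x₁ → Interior k K₀ Ω x₂ → Interior k K₀ Ω y →
    x₁ ≠ x₂ → ∀ Γ : List (HiggsLattice.Site P 0), IsAdm x₁ x₂ Γ →
    (∑ i : Ix N, ‖hol C B x₁ Γ (covDeriv C B (propagatorK C Ω B msq a k (cb P N 0 (y, i))) ⟨x₂, μ⟩)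
        - covDeriv C B (propagatorK C Ω B msq a k (cb P N 0 (y, i))) ⟨x₁, μ⟩‖)
        / (P.mesh 0 * (HiggsLattice.Site.tdist x₁ x₂ : ℝ)) ^ α
      ≤ ∑ j ∈ Finset.range k, cH * P.mesh j ^ (((1 : ℝ) - α) - (P.d : ℝ)) *
          (Real.exp (-(δ₁ * (P.mesh j)⁻¹ * (P.mesh 0 * (HiggsLattice.Site.tdist x₁ y : ℝ)))) +
            Real.exp (-(δ₁ * (P.mesh j)⁻¹ * (P.mesh 0 * (HiggsLattice.Site.tdist x₂ y : ℝ))))))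
include hδ₁ hδ₁1 hCst h210B h210AB hmsq ha hk hkK i₀ hs hA hδA hregA hAS hα1 hcH h211

/-- **THE HÖLDER QUOTIENT OF THE ROW DERIVATIVE OF THE KERNEL OF (1.16) ON A REGION, ALL `n = m+1 ≥ 1`, `n′ ≥ 0`, `d < 1 + (n+n′) − α`,
AT INTERIOR POINTS** — the region twin of `B3Op116HolderKernelRegularTorus.kernel116_holder_le` (print p. 414 at print's region `Ω ⊆ T_ε`
under print's support hypothesis p. 412): for `m² > 0`, `a > 0`, `1 ≤ k ≤ K`, r15's (2.10) bounds `Ineq210 δ₁ C` of `G_k(Ω,B̃)`, `G_k(Ω,Ã+B̃)`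
on r14's carrier (same `K₀`), the region (2.11) row `h211` with constant `cH`, `sup_b|Ã_b| ≤ s`, `Ã` regular with `δ_A` and supported on deep
bonds, interior `x₁ ≠ x₂`, interior `x′`, admissible `Γ`:
`ε^{−d}Σ_{i′}‖U(B̃(Γ))(D^ε_{B̃}(1.16)^Ω_{m+1,n′}e_{(x′,i′)})(⟨x₂,μ⟩) − (D^ε_{B̃}(1.16)^Ω_{m+1,n′}e_{(x′,i′)})(⟨x₁,μ⟩)‖
≤ (ε|x₁−x₂|)^α·holC(m+n′)·(L^kε)^{m+n′+1}·((L^kε)((L^kε)^d)^{−1}((L^kε)^α)^{−1})·exp(−δ_{m+n′+1}·min(|x₁−x′|,|x₂−x′|)/L^k)` — §3 fed with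
p40's `state_op116_cb_region`; the binder `hH` (and, at swapped orders, `hH′`) of `B3Ineq25Op116Smooth.ineq25At_op116_smooth_of_bounds`.
[cite: Balaban1983Higgs3, (1.16) p.414, p.412, (2.5) p.424, (2.10)–(2.11) p.426] [cite: Balaban1982Higgs1, Prop. 2.1 (2.24) p.610] [cite: Balaban1983RegularityDecay, Theorem p.573] -/
theorem kernel116_holder_le_region (m n' : ℕ) (hd : (P.d : ℝ) < 1 + ((m + 1 + n' : ℕ) : ℝ) - α) (μ : Fin P.d)
    (x₁ x₂ x' : HiggsLattice.Site P 0) (hx₁ : Interior k K₀ Ω x₁) (hx₂ : Interior k K₀ Ω x₂) (hx' : Interior k K₀ Ω x')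
    (hne : x₁ ≠ x₂) (Γ : List (HiggsLattice.Site P 0)) (hΓ : IsAdm x₁ x₂ Γ) :
    (P.mesh 0 ^ P.d)⁻¹ * ∑ i' : Ix N,
        ‖hol C B x₁ Γ (covDeriv C B (op116 C Ω A B msq a k (m + 1) n' (cb P N 0 (x', i'))) ⟨x₂, μ⟩)
          - covDeriv C B (op116 C Ω A B msq a k (m + 1) n' (cb P N 0 (x', i'))) ⟨x₁, μ⟩‖
      ≤ (P.mesh 0 * (HiggsLattice.Site.tdist x₁ x₂ : ℝ)) ^ α *
          (holC P N C k a δ₁ Cst s δA α cH (m + n') * P.mesh k ^ (m + n' + 1) *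
            (P.mesh k * (P.mesh k ^ P.d)⁻¹ * (P.mesh k ^ α)⁻¹)) *
          Real.exp (-(rateAt P N C k a Cst s δA δ₁ (P.mesh 0 ^ P.d * Cst) (cK1 P C k Cst s) (m + n' + 1) *
            (min (HiggsLattice.Site.tdist x₁ x' : ℝ) (HiggsLattice.Site.tdist x₂ x' : ℝ) / (P.L : ℝ) ^ k))) :=
  kernel116_holder_le_region_of_state hδ₁ hδ₁1 hCst hk hkK i₀ hs hA hδA hregA hAS hα1 hcH h211 hL1 m n' hd μ x₁ x₂ x' hx₁ hx₂ hne Γ hΓ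
    (fun i' => state_op116_cb_region hδ₁ hδ₁1 hCst h210B h210AB hmsq ha hk hkK i₀ hs hA hδA hregA hAS hx' m n' i')

/-- **THE HÖLDER QUOTIENT AT `n = 0`, ALL `n′+1 ≥ 1`, `d < 1 + (n′+1) − α`, AT INTERIOR POINTS, PACKAGED** (`L^kε ≤ 1`) — the region twin of
`B3Op116HolderKernelRegularTorusZero.kernel116_holder_le_zero_left'`: under the same hypotheses,
`ε^{−d}Σ_{i′}‖U(B̃(Γ))(D^ε_{B̃}(1.16)^Ω_{0,n′+1}e_{(x′,i′)})(⟨x₂,μ⟩) − (…)(⟨x₁,μ⟩)‖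
≤ (ε|x₁−x₂|)^α·((holC(n′) + holC(n′+1))·(L^kε)^{n′+1}·(L^kε)((L^kε)^d)^{−1}((L^kε)^α)^{−1})·exp(−δ_{n′+2}·min(|x₁−x′|,|x₂−x′|)/L^k)` — §3 fed
with p40's `state_chainB_region` (from `base_state_region` at `X = B̃`) and `state_op116_cb_region 0 (n′+1)`.
[cite: Balaban1983Higgs3, (1.16) p.414, p.412, (2.5) p.424, (2.10)–(2.11) p.426] [cite: Balaban1982Higgs1, Prop. 2.1 (2.24) p.610, (3.44) p.619] -/
theorem kernel116_holder_le_zero_left_region' (hmesh : P.mesh k ≤ 1) (n' : ℕ) (hd : (P.d : ℝ) < 1 + ((n' + 1 : ℕ) : ℝ) - α)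
    (μ : Fin P.d) (x₁ x₂ x' : HiggsLattice.Site P 0) (hx₁ : Interior k K₀ Ω x₁) (hx₂ : Interior k K₀ Ω x₂) (hx' : Interior k K₀ Ω x')
    (hne : x₁ ≠ x₂) (Γ : List (HiggsLattice.Site P 0)) (hΓ : IsAdm x₁ x₂ Γ) :
    (P.mesh 0 ^ P.d)⁻¹ * ∑ i' : Ix N,
        ‖hol C B x₁ Γ (covDeriv C B (op116 C Ω A B msq a k 0 (n' + 1) (cb P N 0 (x', i'))) ⟨x₂, μ⟩)
          - covDeriv C B (op116 C Ω A B msq a k 0 (n' + 1) (cb P N 0 (x', i'))) ⟨x₁, μ⟩‖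
      ≤ (P.mesh 0 * (HiggsLattice.Site.tdist x₁ x₂ : ℝ)) ^ α *
          ((holC P N C k a δ₁ Cst s δA α cH n' + holC P N C k a δ₁ Cst s δA α cH (n' + 1)) * P.mesh k ^ (n' + 1) *
            (P.mesh k * (P.mesh k ^ P.d)⁻¹ * (P.mesh k ^ α)⁻¹)) *
          Real.exp (-(rateAt P N C k a Cst s δA δ₁ (P.mesh 0 ^ P.d * Cst) (cK1 P C k Cst s) (n' + 2) *
            (min (HiggsLattice.Site.tdist x₁ x' : ℝ) (HiggsLattice.Site.tdist x₂ x' : ℝ) / (P.L : ℝ) ^ k))) := by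
  have hc : 0 ≤ P.mesh 0 ^ P.d * Cst := mul_nonneg (pow_nonneg (P.mesh_pos 0).le _) hCst
  obtain ⟨-, hcK1⟩ := cK1_ge (P := P) (C := C) (k := k) hCst hs
  refine kernel116_holder_le_zero_left_region_of_state' hδ₁ hδ₁1 hCst hk hkK i₀ hs hA hδA hregA hAS hα1 hcH h211 hL1 hmsq ha hmesh n' hd
    μ x₁ x₂ x' hx₁ hx₂ hne Γ hΓ (fun i' => ?_)
    (fun i' => state_op116_cb_region hδ₁ hδ₁1 hCst h210B h210AB hmsq ha hk hkK i₀ hs hA hδA hregA hAS hx' 0 (n' + 1) i')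
  -- the pure-B̃ chain at the interior x′ is in the region state n′ (p40's `base_state_region` at X = B̃ + `state_chainB_region`)
  have h0 := base_state_region (δA := δA) hδ₁ hδ₁1 hCst h210B h210AB hmsq ha hk hkK hs hA hAS hx' i' B (Or.inl rfl)
  have h := state_chainB_region hδ₁ hδ₁1 hCst h210B h210AB hmsq ha hk hkK i₀ hs hA hδA hregA hAS hδ₁ le_rfl hc hcK1 x' n' 0 _ h0
  simp only [Nat.zero_add] at h
  exact h

end Closed

end Literature.MathematicalPhysics.QuantumFieldTheory.Balaban1983to89.B3Op116HolderKernelRegularRegion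

end
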